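import Summits.QuantumFields.YangMills.Theorems.BalabanUVNodesPortU8LResponse
import Summits.QuantumFields.YangMills.Theorems.BalabanUVNodesPortU8IotaC2Transport
import Literature.MathematicalPhysics.QuantumFieldTheory.Balaban1983to89.Node00.CriticalOnFibreTopGuardedBPrint
import Literature.MathematicalPhysics.QuantumFieldTheory.Balaban1983to89.Node00.Record12BgRowCoClassCPMFloorB
import Literature.MathematicalPhysics.QuantumFieldTheory.Balaban1983to89.Node00.TorusCoverGaugeTokensGuardedB

/-!
# PORT PT-B (U8), g2 file 7 — THE CONDITIONAL SKELETON AGAINST 27931 v9-L «⁷‴» (`ce176c419bf63055`, SIGNED 2026-08-31T01:31:48Z after RC-2 ∕ Q-12): the signed text FROM the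
# two-volume row (R4ᴰ) ALONE — (R1ᴰ) for the (21)-Landau response `recordGkL` is now DISCHARGED by the text's own TokP9L4‴ token (four (190)-clauses on `recordHr`) through file 6
# (`rowR1D_L_at`), the `𝐉`-block by port M, (C2a)(C2b) by g0 files 1∕5, (R0)(R3)(R5) by g0 files 2–3 — `--supports stmt-QuantumFields-27931` (conditional on (R4ᴰ); NOT a closer)

Cell `ym-nodeO-ideate` ∕ `ym-balaban-port`, porter `ymgap-nodeO-port-PTB-1` (gen 2), item **stmt-QuantumFields-27931** `BalabanUVNodes.PortPieceLocalityU8`.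
[I] = [Balaban1987RG1], [15] = [Balaban1985Variational].
WHAT THIS FILE PROVES (one theorem; no `def ∕ instance ∕ notation ∕ sorry`; standard axioms): ★★★ `portPieceLocalityU8_v10_of hR4 : <v9-L verbatim>` — `hR4` = v9-L's antecedent ⟹
`∀ α₂ > 0, ∃ C₄ δ₄`, the two-volume row (R4ᴰ) for `recordGkL`.  RESIDUE OF v9-L = EXACTLY {(R4ᴰ)} ([I] (1.21) p.264: the linearised Landau minimisers on `T_K` and `T_{K+1}` agree on the
centred window up to `C·e^{−δR∕2}·e^{−δ·dist∕2}` — content, or definitional under DEF-1's later (H) localized edition).  Constants: `C₉ := max (2(2C₉′ + 2‖π_ℝ‖C₉′ + 1)e^{4δ₉Mc}∕α₂) C₄`,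
`δ₀ := min δ₉ δ₄`.
HONEST FRAMING.  A conditional assembly; NOTHING of Bałaban's analysis asserted, ported or discharged; 27931 OPEN — this file cannot and does not close it ((R4ᴰ) displayed); K0⁷ NOT closed;
NODE O 0∕1; COUNT 8∕28 · K 1∕4 UNMOVED; finite `𝕋⁴_{L^K}` at fixed ε — NOT continuum ∕ OS ∕ Clay; **the Yang–Mills mass gap (Clay) is NOT proved.**
-/

noncomputable section

open scoped BigOperators Matrix.Norms.L2Operator

namespace Summit.QuantumFields.YangMills.Theorems.PortU8

open Literature.MathematicalPhysics.QuantumFieldTheory.Balaban1983to89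
open Literature.MathematicalPhysics.QuantumFieldTheory.Balaban1983to89.Node00
open Literature.MathematicalPhysics.QuantumFieldTheory.Balaban1983to89.T4Continuum (T4Family)
open Summit.QuantumFields.YangMills.Theorems.K0RecordFormatNames

/-- ★★★ **THE CONDITIONAL SKELETON AGAINST 27931 v9-L** (`ce176c419bf63055`, the SIGNED string of record after RC-2): the signed text, verbatim, FROM the displayed two-volume row
(R4ᴰ) for the Landau response `recordGkL` under v9-L's own antecedent; (R1ᴰ) comes from the TokP9L4‴ token via `rowR1D_L_at`, everything else from g0∕g2 files.  Conditional:
closes nothing; residue of v9-L = EXACTLY {(R4ᴰ)}. [cite: Balaban1987RG1, (1.7)–(1.8) p.261, (1.21) p.264, (4.2)–(4.5) pp.281–282, (4.35) p.290; Balaban1985Variational, Prop. 9 p.309, (190) p.308, (21) p.281] -/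
theorem portPieceLocalityU8_v10_of
    (hR4 : ∀ (F : Literature.MathematicalPhysics.QuantumFieldTheory.Balaban1983to89.T4Continuum.T4Family) (Mc : ℕ) (j c c₀ c₁ : ℕ) (B₃ B₃' a₀ a₁ : ℝ), Summit.QuantumFields.YangMills.Theorems.K0RecordFormatNames.McGuard F Mc → c ≤ F.L ^ j → c₀ ≤ j + 1 → c₁ ≤ j → 2 * (F.L : ℝ) ^ 2 ≤ B₃ → 0 < B₃' → 0 < a₀ → 0 < a₁ → Literature.MathematicalPhysics.QuantumFieldTheory.Balaban1983to89.Node00.VariationalThm1RegSepCoP7MGB F 2 (fun ν M g K k _s => c ≤ ν.M₁ ∧ k + c₀ ≤ F.m + K ∧ F.L ^ c₁ ∣ M ∧ ∀ i, 1 ≤ i → i ≤ k → Literature.MathematicalPhysics.QuantumFieldTheory.Balaban1983to89.Node00.dCubeSide (F.P K).L M (Literature.MathematicalPhysics.QuantumFieldTheory.Balaban1983to89.Node00.RkOfRecord (F.P K).L ν.r (g i)) i ∣ (F.P K).sitesPerDir 0) (Literature.MathematicalPhysics.QuantumFieldTheory.Balaban1983to89.Node00.lamDatum F) (Literature.MathematicalPhysics.QuantumFieldTheory.Balaban1983to89.Node00.dataSmall7LamTopOf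 F 2) B₃ a₀ a₁ → Literature.MathematicalPhysics.QuantumFieldTheory.Balaban1983to89.Node00.Gauge9RegSepTopStepGB F 2 (fun ν K Ω => Literature.MathematicalPhysics.QuantumFieldTheory.Balaban1983to89.Node00.suppDomOfRecord F ν K Ω) (F.L ^ j) (fun ν M g K k _s => c ≤ ν.M₁ ∧ k + c₀ ≤ F.m + K ∧ F.L ^ c₁ ∣ M ∧ ∀ i, 1 ≤ i → i ≤ k → Literature.MathematicalPhysics.QuantumFieldTheory.Balaban1983to89.Node00.dCubeSide (F.P K).L M (Literature.MathematicalPhysics.QuantumFieldTheory.Balaban1983to89.Node00.RkOfRecord (F.P K).L ν.r (g i)) i ∣ (F.P K).sitesPerDir 0) (Literature.MathematicalPhysics.QuantumFieldTheory.Balaban1983to89.Node00.lamDatum F) (Literature.MathematicalPhysics.QuantumFieldTheory.Balaban1983to89.Node00.dataSmall7LamTopOf F 2) B₃ B₃' a₀ a₁ → (∀ ε₁ : ℝ, 0 < ε₁ → ε₁ ≤ a₁ → B₃ * ε₁ ≤ a₀ → ∀ (k n : ℕ) (V : Literature.MathematicalPhysics.QuantumFieldTheory.Balaban1983to89.GaugeField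 (F.P (Summit.QuantumFields.YangMills.Theorems.K0RecordFormatNames.recordK₀ F Mc k + n)) (k + 1) (Literature.MathematicalPhysics.QuantumFieldTheory.Balaban1983to89.Node00.SU 2)), Literature.MathematicalPhysics.QuantumFieldTheory.Balaban1983to89.PlaqSmall ε₁ V → Literature.MathematicalPhysics.QuantumFieldTheory.Balaban1983to89.Node00.UkExists F 2 (Summit.QuantumFields.YangMills.Theorems.K0RecordFormatNames.recordK₀ F Mc k + n) (k + 1) a₀ V ∧ Literature.MathematicalPhysics.QuantumFieldTheory.Balaban1983to89.Node00.UniqueUkOrbit F 2 (Summit.QuantumFields.YangMills.Theorems.K0RecordFormatNames.recordK₀ F Mc k + n) (k + 1) a₀ V) → (∀ (k n : ℕ) (ε₂₉ : ℝ), 0 < ε₂₉ → letI θ := Summit.QuantumFields.YangMills.Theorems.K0RecordFormatNames.thetaFill F a₀ ε₂₉; letI := θ.instVβ₁; letI := θ.instVβ₂; letI := θ.instιβ; AnalyticAt ℝ (fun B : Summit.QuantumFields.YangMills.Theorems.K0RecordFormatNames.recordW F a₀ ε₂₉ k (Summit.QuantumFields.YangMills.Theorems.K0RecordFormatNames.recordK₀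 F Mc k + n) => fun (b : Literature.MathematicalPhysics.QuantumFieldTheory.Balaban1983to89.PBond (F.P (Summit.QuantumFields.YangMills.Theorems.K0RecordFormatNames.recordK₀ F Mc k + n)) 0) (i i' : Fin 2) => ((Summit.QuantumFields.YangMills.Theorems.K0RecordFormatNames.recordBgField F θ k (Summit.QuantumFields.YangMills.Theorems.K0RecordFormatNames.recordK₀ F Mc k + n) B b : Literature.MathematicalPhysics.QuantumFieldTheory.Balaban1983to89.Node00.SU 2) : Matrix (Fin 2) (Fin 2) ℂ) i i') 0) → (∃ C₉' δ₉ : ℝ, 0 ≤ C₉' ∧ 0 < δ₉ ∧ ∀ (k n : ℕ) (ε₂₉ : ℝ), 0 < ε₂₉ → letI θ := Summit.QuantumFields.YangMills.Theorems.K0RecordFormatNames.thetaFill F a₀ ε₂₉; letI := θ.instVβ₁; letI := θ.instVβ₂; letI := θ.instιβ; ∀ (a : θ.ιβ) (μ : Fin (F.P (Summit.QuantumFields.YangMills.Theorems.K0RecordFormatNames.recordK₀ F Mc k + n)).d) (y : Literature.MathematicalPhysics.QuantumFieldTheory.Balaban1983to89.Site (F.P (Summit.QuantumFields.YangMills.Theorems.K0RecordFormatNames.recordK₀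 F Mc k + n)) (k + 1)), letI Hr : Literature.MathematicalPhysics.QuantumFieldTheory.Balaban1983to89.PBond (F.P (Summit.QuantumFields.YangMills.Theorems.K0RecordFormatNames.recordK₀ F Mc k + n)) 0 → Fin 2 → Fin 2 → ℂ := fun b' => Summit.QuantumFields.YangMills.Theorems.K0RecordFormatNames.recordHr F θ k (Summit.QuantumFields.YangMills.Theorems.K0RecordFormatNames.recordK₀ F Mc k + n) a (μ, y) b'; ∀ b : Literature.MathematicalPhysics.QuantumFieldTheory.Balaban1983to89.PBond (F.P (Summit.QuantumFields.YangMills.Theorems.K0RecordFormatNames.recordK₀ F Mc k + n)) 0, ‖Hr b‖ ≤ C₉' * (F.P (Summit.QuantumFields.YangMills.Theorems.K0RecordFormatNames.recordK₀ F Mc k + n)).eta (k + 1) * Real.exp (-(δ₉ * (Literature.MathematicalPhysics.QuantumFieldTheory.Balaban1983to89.Site.tdist (Summit.QuantumFields.YangMills.Theorems.K0RecordFormatNames.coarsenTo (k + 1) b.src) y : ℝ))) ∧ (∀ ν : Fin (F.P (Summit.QuantumFields.YangMills.Theorems.K0RecordFormatNames.recordK₀ F Mc k + n)).d, ‖Hr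 (⟨b.src.shift ν, b.dir⟩ : Literature.MathematicalPhysics.QuantumFieldTheory.Balaban1983to89.PBond (F.P (Summit.QuantumFields.YangMills.Theorems.K0RecordFormatNames.recordK₀ F Mc k + n)) 0) - Hr b‖ ≤ C₉' * (F.P (Summit.QuantumFields.YangMills.Theorems.K0RecordFormatNames.recordK₀ F Mc k + n)).eta (k + 1) ^ 2 * Real.exp (-(δ₉ * (Literature.MathematicalPhysics.QuantumFieldTheory.Balaban1983to89.Site.tdist (Summit.QuantumFields.YangMills.Theorems.K0RecordFormatNames.coarsenTo (k + 1) b.src) y : ℝ)))) ∧ ‖∑ ν : Fin (F.P (Summit.QuantumFields.YangMills.Theorems.K0RecordFormatNames.recordK₀ F Mc k + n)).d, (Hr (⟨b.src.shift ν, b.dir⟩ : Literature.MathematicalPhysics.QuantumFieldTheory.Balaban1983to89.PBond (F.P (Summit.QuantumFields.YangMills.Theorems.K0RecordFormatNames.recordK₀ F Mc k + n)) 0) - (2 : ℂ) • Hr b + Hr (⟨b.src.unshift ν, b.dir⟩ : Literature.MathematicalPhysics.QuantumFieldTheory.Balaban1983to89.PBond (F.P (Summit.QuantumFields.YangMills.Theorems.K0RecordFormatNames.recordK₀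 F Mc k + n)) 0))‖ ≤ C₉' * (F.P (Summit.QuantumFields.YangMills.Theorems.K0RecordFormatNames.recordK₀ F Mc k + n)).eta (k + 1) ^ 3 * Real.exp (-(δ₉ * (Literature.MathematicalPhysics.QuantumFieldTheory.Balaban1983to89.Site.tdist (Summit.QuantumFields.YangMills.Theorems.K0RecordFormatNames.coarsenTo (k + 1) b.src) y : ℝ))) ∧ ‖∑ ν : Fin (F.P (Summit.QuantumFields.YangMills.Theorems.K0RecordFormatNames.recordK₀ F Mc k + n)).d, ((Hr (⟨b.src, b.dir⟩ : Literature.MathematicalPhysics.QuantumFieldTheory.Balaban1983to89.PBond (F.P (Summit.QuantumFields.YangMills.Theorems.K0RecordFormatNames.recordK₀ F Mc k + n)) 0) + Hr (⟨(b.src).shift b.dir, ν⟩ : Literature.MathematicalPhysics.QuantumFieldTheory.Balaban1983to89.PBond (F.P (Summit.QuantumFields.YangMills.Theorems.K0RecordFormatNames.recordK₀ F Mc k + n)) 0) - Hr (⟨(b.src).shift ν, b.dir⟩ : Literature.MathematicalPhysics.QuantumFieldTheory.Balaban1983to89.PBond (F.P (Summit.QuantumFields.YangMills.Theorems.K0RecordFormatNames.recordK₀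 F Mc k + n)) 0) - Hr (⟨b.src, ν⟩ : Literature.MathematicalPhysics.QuantumFieldTheory.Balaban1983to89.PBond (F.P (Summit.QuantumFields.YangMills.Theorems.K0RecordFormatNames.recordK₀ F Mc k + n)) 0)) - (Hr (⟨b.src.unshift ν, b.dir⟩ : Literature.MathematicalPhysics.QuantumFieldTheory.Balaban1983to89.PBond (F.P (Summit.QuantumFields.YangMills.Theorems.K0RecordFormatNames.recordK₀ F Mc k + n)) 0) + Hr (⟨(b.src.unshift ν).shift b.dir, ν⟩ : Literature.MathematicalPhysics.QuantumFieldTheory.Balaban1983to89.PBond (F.P (Summit.QuantumFields.YangMills.Theorems.K0RecordFormatNames.recordK₀ F Mc k + n)) 0) - Hr (⟨(b.src.unshift ν).shift ν, b.dir⟩ : Literature.MathematicalPhysics.QuantumFieldTheory.Balaban1983to89.PBond (F.P (Summit.QuantumFields.YangMills.Theorems.K0RecordFormatNames.recordK₀ F Mc k + n)) 0) - Hr (⟨b.src.unshift ν, ν⟩ : Literature.MathematicalPhysics.QuantumFieldTheory.Balaban1983to89.PBond (F.P (Summit.QuantumFields.YangMills.Theorems.K0RecordFormatNames.recordK₀ F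 Mc k + n)) 0)))‖ ≤ C₉' * (F.P (Summit.QuantumFields.YangMills.Theorems.K0RecordFormatNames.recordK₀ F Mc k + n)).eta (k + 1) ^ 3 * Real.exp (-(δ₉ * (Literature.MathematicalPhysics.QuantumFieldTheory.Balaban1983to89.Site.tdist (Summit.QuantumFields.YangMills.Theorems.K0RecordFormatNames.coarsenTo (k + 1) b.src) y : ℝ)))) → ∀ α₂ : ℝ, 0 < α₂ → ∃ C₄ δ₄ : ℝ, 0 ≤ C₄ ∧ 0 < δ₄ ∧ ∀ k : ℕ, ∀ ε₂₉ : ℝ, 0 < ε₂₉ → ∀ a : (Summit.QuantumFields.YangMills.Theorems.K0RecordFormatNames.thetaFill F a₀ ε₂₉).ιβ, (∀ (n : ℕ) (X : (Summit.QuantumFields.YangMills.Theorems.K0RecordFormatNames.recordDomSys F Mc k (Summit.QuantumFields.YangMills.Theorems.K0RecordFormatNames.recordK₀ F Mc k + n)).Dom), X ∉ Summit.QuantumFields.YangMills.Theorems.K0RecordFormatNames.recordWrapCtr F Mc k (Summit.QuantumFields.YangMills.Theorems.K0RecordFormatNames.recordK₀ F Mc k + n) → ∀ (μ : Fin 4)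 (z : Fin 4 → ℤ), (∀ l, 2 * |z l| < (Summit.QuantumFields.YangMills.Theorems.K0RecordFormatNames.recordRNat F Mc k (Summit.QuantumFields.YangMills.Theorems.K0RecordFormatNames.recordK₀ F Mc k + n) : ℤ)) → gauge (Summit.QuantumFields.YangMills.Theorems.K0RecordFormatNames.recordDom44J F Mc k (Summit.QuantumFields.YangMills.Theorems.K0RecordFormatNames.recordK₀ F Mc k + n) X α₂) (Literature.MathematicalPhysics.QuantumFieldTheory.Balaban1983to89.B12FormatPlus.cutTo (Summit.QuantumFields.YangMills.Theorems.K0RecordFormatNames.recordCXJ F Mc k (Summit.QuantumFields.YangMills.Theorems.K0RecordFormatNames.recordK₀ F Mc k + n) X) fun i => Summit.QuantumFields.YangMills.Theorems.K0RecordFormatNames.recordGkL F (Summit.QuantumFields.YangMills.Theorems.K0RecordFormatNames.thetaFill F a₀ ε₂₉) k (Summit.QuantumFields.YangMills.Theorems.K0RecordFormatNames.recordK₀ F Mc k + (n + 1)) a (Summit.QuantumFields.YangMills.Theorems.K0RecordFormatNames.recordE F k (Summit.QuantumFields.YangMills.Theorems.K0RecordFormatNames.recordK₀ F Mc k + (n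 + 1)) μ z) (Summit.QuantumFields.YangMills.Theorems.K0RecordFormatNames.recordJXJ F (Summit.QuantumFields.YangMills.Theorems.K0RecordFormatNames.recordK₀ F Mc k + n) i) - Summit.QuantumFields.YangMills.Theorems.K0RecordFormatNames.recordGkL F (Summit.QuantumFields.YangMills.Theorems.K0RecordFormatNames.thetaFill F a₀ ε₂₉) k (Summit.QuantumFields.YangMills.Theorems.K0RecordFormatNames.recordK₀ F Mc k + n) a (Summit.QuantumFields.YangMills.Theorems.K0RecordFormatNames.recordE F k (Summit.QuantumFields.YangMills.Theorems.K0RecordFormatNames.recordK₀ F Mc k + n) μ z) i) ≤ C₄ * Real.exp (-δ₄ * (Summit.QuantumFields.YangMills.Theorems.K0RecordFormatNames.recordRNat F Mc k (Summit.QuantumFields.YangMills.Theorems.K0RecordFormatNames.recordK₀ F Mc k + n) : ℝ) / 2) * Real.exp (-(δ₄ / 2) * (Summit.QuantumFields.YangMills.Theorems.K0RecordFormatNames.recordSiteGeom F Mc k (Summit.QuantumFields.YangMills.Theorems.K0RecordFormatNames.recordK₀ F Mc k + n)).distD (Summit.QuantumFields.YangMills.Theorems.K0RecordFormatNames.recordE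 F k (Summit.QuantumFields.YangMills.Theorems.K0RecordFormatNames.recordK₀ F Mc k + n) μ z) X))) :
    ∀ (F : Literature.MathematicalPhysics.QuantumFieldTheory.Balaban1983to89.T4Continuum.T4Family) (Mc : ℕ) (j c c₀ c₁ : ℕ) (B₃ B₃' a₀ a₁ : ℝ), Summit.QuantumFields.YangMills.Theorems.K0RecordFormatNames.McGuard F Mc → c ≤ F.L ^ j → c₀ ≤ j + 1 → c₁ ≤ j → 2 * (F.L : ℝ) ^ 2 ≤ B₃ → 0 < B₃' → 0 < a₀ → 0 < a₁ → Literature.MathematicalPhysics.QuantumFieldTheory.Balaban1983to89.Node00.VariationalThm1RegSepCoP7MGB F 2 (fun ν M g K k _s => c ≤ ν.M₁ ∧ k + c₀ ≤ F.m + K ∧ F.L ^ c₁ ∣ M ∧ ∀ i, 1 ≤ i → i ≤ k → Literature.MathematicalPhysics.QuantumFieldTheory.Balaban1983to89.Node00.dCubeSide (F.P K).L M (Literature.MathematicalPhysics.QuantumFieldTheory.Balaban1983to89.Node00.RkOfRecord (F.P K).L ν.r (g i)) i ∣ (F.P K).sitesPerDir 0) (Literature.MathematicalPhysics.QuantumFieldTheory.Balaban1983to89.Node00.lamDatum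 F) (Literature.MathematicalPhysics.QuantumFieldTheory.Balaban1983to89.Node00.dataSmall7LamTopOf F 2) B₃ a₀ a₁ → Literature.MathematicalPhysics.QuantumFieldTheory.Balaban1983to89.Node00.Gauge9RegSepTopStepGB F 2 (fun ν K Ω => Literature.MathematicalPhysics.QuantumFieldTheory.Balaban1983to89.Node00.suppDomOfRecord F ν K Ω) (F.L ^ j) (fun ν M g K k _s => c ≤ ν.M₁ ∧ k + c₀ ≤ F.m + K ∧ F.L ^ c₁ ∣ M ∧ ∀ i, 1 ≤ i → i ≤ k → Literature.MathematicalPhysics.QuantumFieldTheory.Balaban1983to89.Node00.dCubeSide (F.P K).L M (Literature.MathematicalPhysics.QuantumFieldTheory.Balaban1983to89.Node00.RkOfRecord (F.P K).L ν.r (g i)) i ∣ (F.P K).sitesPerDir 0) (Literature.MathematicalPhysics.QuantumFieldTheory.Balaban1983to89.Node00.lamDatum F) (Literature.MathematicalPhysics.QuantumFieldTheory.Balaban1983to89.Node00.dataSmall7LamTopOf F 2) B₃ B₃' a₀ a₁ → (∀ ε₁ : ℝ, 0 < ε₁ → ε₁ ≤ a₁ → B₃ * ε₁ ≤ a₀ →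 ∀ (k n : ℕ) (V : Literature.MathematicalPhysics.QuantumFieldTheory.Balaban1983to89.GaugeField (F.P (Summit.QuantumFields.YangMills.Theorems.K0RecordFormatNames.recordK₀ F Mc k + n)) (k + 1) (Literature.MathematicalPhysics.QuantumFieldTheory.Balaban1983to89.Node00.SU 2)), Literature.MathematicalPhysics.QuantumFieldTheory.Balaban1983to89.PlaqSmall ε₁ V → Literature.MathematicalPhysics.QuantumFieldTheory.Balaban1983to89.Node00.UkExists F 2 (Summit.QuantumFields.YangMills.Theorems.K0RecordFormatNames.recordK₀ F Mc k + n) (k + 1) a₀ V ∧ Literature.MathematicalPhysics.QuantumFieldTheory.Balaban1983to89.Node00.UniqueUkOrbit F 2 (Summit.QuantumFields.YangMills.Theorems.K0RecordFormatNames.recordK₀ F Mc k + n) (k + 1) a₀ V) → (∀ (k n : ℕ) (ε₂₉ : ℝ), 0 < ε₂₉ → letI θ := Summit.QuantumFields.YangMills.Theorems.K0RecordFormatNames.thetaFill F a₀ ε₂₉; letI := θ.instVβ₁; letI := θ.instVβ₂; letI := θ.instιβ; AnalyticAt ℝ (fun B : Summit.QuantumFields.YangMills.Theorems.K0RecordFormatNames.recordW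 F a₀ ε₂₉ k (Summit.QuantumFields.YangMills.Theorems.K0RecordFormatNames.recordK₀ F Mc k + n) => fun (b : Literature.MathematicalPhysics.QuantumFieldTheory.Balaban1983to89.PBond (F.P (Summit.QuantumFields.YangMills.Theorems.K0RecordFormatNames.recordK₀ F Mc k + n)) 0) (i i' : Fin 2) => ((Summit.QuantumFields.YangMills.Theorems.K0RecordFormatNames.recordBgField F θ k (Summit.QuantumFields.YangMills.Theorems.K0RecordFormatNames.recordK₀ F Mc k + n) B b : Literature.MathematicalPhysics.QuantumFieldTheory.Balaban1983to89.Node00.SU 2) : Matrix (Fin 2) (Fin 2) ℂ) i i') 0) → (∃ C₉' δ₉ : ℝ, 0 ≤ C₉' ∧ 0 < δ₉ ∧ ∀ (k n : ℕ) (ε₂₉ : ℝ), 0 < ε₂₉ → letI θ := Summit.QuantumFields.YangMills.Theorems.K0RecordFormatNames.thetaFill F a₀ ε₂₉; letI := θ.instVβ₁; letI := θ.instVβ₂; letI := θ.instιβ; ∀ (a : θ.ιβ) (μ : Fin (F.P (Summit.QuantumFields.YangMills.Theorems.K0RecordFormatNames.recordK₀ F Mc k + n)).d) (y : Literature.MathematicalPhysics.QuantumFieldTheory.Balaban1983to89.Site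 (F.P (Summit.QuantumFields.YangMills.Theorems.K0RecordFormatNames.recordK₀ F Mc k + n)) (k + 1)), letI Hr : Literature.MathematicalPhysics.QuantumFieldTheory.Balaban1983to89.PBond (F.P (Summit.QuantumFields.YangMills.Theorems.K0RecordFormatNames.recordK₀ F Mc k + n)) 0 → Fin 2 → Fin 2 → ℂ := fun b' => Summit.QuantumFields.YangMills.Theorems.K0RecordFormatNames.recordHr F θ k (Summit.QuantumFields.YangMills.Theorems.K0RecordFormatNames.recordK₀ F Mc k + n) a (μ, y) b'; ∀ b : Literature.MathematicalPhysics.QuantumFieldTheory.Balaban1983to89.PBond (F.P (Summit.QuantumFields.YangMills.Theorems.K0RecordFormatNames.recordK₀ F Mc k + n)) 0, ‖Hr b‖ ≤ C₉' * (F.P (Summit.QuantumFields.YangMills.Theorems.K0RecordFormatNames.recordK₀ F Mc k + n)).eta (k + 1) * Real.exp (-(δ₉ * (Literature.MathematicalPhysics.QuantumFieldTheory.Balaban1983to89.Site.tdist (Summit.QuantumFields.YangMills.Theorems.K0RecordFormatNames.coarsenTo (k + 1) b.src) y : ℝ))) ∧ (∀ ν : Fin (F.P (Summit.QuantumFields.YangMills.Theorems.K0RecordFormatNames.recordK₀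 F Mc k + n)).d, ‖Hr (⟨b.src.shift ν, b.dir⟩ : Literature.MathematicalPhysics.QuantumFieldTheory.Balaban1983to89.PBond (F.P (Summit.QuantumFields.YangMills.Theorems.K0RecordFormatNames.recordK₀ F Mc k + n)) 0) - Hr b‖ ≤ C₉' * (F.P (Summit.QuantumFields.YangMills.Theorems.K0RecordFormatNames.recordK₀ F Mc k + n)).eta (k + 1) ^ 2 * Real.exp (-(δ₉ * (Literature.MathematicalPhysics.QuantumFieldTheory.Balaban1983to89.Site.tdist (Summit.QuantumFields.YangMills.Theorems.K0RecordFormatNames.coarsenTo (k + 1) b.src) y : ℝ)))) ∧ ‖∑ ν : Fin (F.P (Summit.QuantumFields.YangMills.Theorems.K0RecordFormatNames.recordK₀ F Mc k + n)).d, (Hr (⟨b.src.shift ν, b.dir⟩ : Literature.MathematicalPhysics.QuantumFieldTheory.Balaban1983to89.PBond (F.P (Summit.QuantumFields.YangMills.Theorems.K0RecordFormatNames.recordK₀ F Mc k + n)) 0) - (2 : ℂ) • Hr b + Hr (⟨b.src.unshift ν, b.dir⟩ : Literature.MathematicalPhysics.QuantumFieldTheory.Balaban1983to89.PBond (F.P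 (Summit.QuantumFields.YangMills.Theorems.K0RecordFormatNames.recordK₀ F Mc k + n)) 0))‖ ≤ C₉' * (F.P (Summit.QuantumFields.YangMills.Theorems.K0RecordFormatNames.recordK₀ F Mc k + n)).eta (k + 1) ^ 3 * Real.exp (-(δ₉ * (Literature.MathematicalPhysics.QuantumFieldTheory.Balaban1983to89.Site.tdist (Summit.QuantumFields.YangMills.Theorems.K0RecordFormatNames.coarsenTo (k + 1) b.src) y : ℝ))) ∧ ‖∑ ν : Fin (F.P (Summit.QuantumFields.YangMills.Theorems.K0RecordFormatNames.recordK₀ F Mc k + n)).d, ((Hr (⟨b.src, b.dir⟩ : Literature.MathematicalPhysics.QuantumFieldTheory.Balaban1983to89.PBond (F.P (Summit.QuantumFields.YangMills.Theorems.K0RecordFormatNames.recordK₀ F Mc k + n)) 0) + Hr (⟨(b.src).shift b.dir, ν⟩ : Literature.MathematicalPhysics.QuantumFieldTheory.Balaban1983to89.PBond (F.P (Summit.QuantumFields.YangMills.Theorems.K0RecordFormatNames.recordK₀ F Mc k + n)) 0) - Hr (⟨(b.src).shift ν, b.dir⟩ : Literature.MathematicalPhysics.QuantumFieldTheory.Balaban1983to89.PBond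 (F.P (Summit.QuantumFields.YangMills.Theorems.K0RecordFormatNames.recordK₀ F Mc k + n)) 0) - Hr (⟨b.src, ν⟩ : Literature.MathematicalPhysics.QuantumFieldTheory.Balaban1983to89.PBond (F.P (Summit.QuantumFields.YangMills.Theorems.K0RecordFormatNames.recordK₀ F Mc k + n)) 0)) - (Hr (⟨b.src.unshift ν, b.dir⟩ : Literature.MathematicalPhysics.QuantumFieldTheory.Balaban1983to89.PBond (F.P (Summit.QuantumFields.YangMills.Theorems.K0RecordFormatNames.recordK₀ F Mc k + n)) 0) + Hr (⟨(b.src.unshift ν).shift b.dir, ν⟩ : Literature.MathematicalPhysics.QuantumFieldTheory.Balaban1983to89.PBond (F.P (Summit.QuantumFields.YangMills.Theorems.K0RecordFormatNames.recordK₀ F Mc k + n)) 0) - Hr (⟨(b.src.unshift ν).shift ν, b.dir⟩ : Literature.MathematicalPhysics.QuantumFieldTheory.Balaban1983to89.PBond (F.P (Summit.QuantumFields.YangMills.Theorems.K0RecordFormatNames.recordK₀ F Mc k + n)) 0) - Hr (⟨b.src.unshift ν, ν⟩ : Literature.MathematicalPhysics.QuantumFieldTheory.Balaban1983to89.PBond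 (F.P (Summit.QuantumFields.YangMills.Theorems.K0RecordFormatNames.recordK₀ F Mc k + n)) 0)))‖ ≤ C₉' * (F.P (Summit.QuantumFields.YangMills.Theorems.K0RecordFormatNames.recordK₀ F Mc k + n)).eta (k + 1) ^ 3 * Real.exp (-(δ₉ * (Literature.MathematicalPhysics.QuantumFieldTheory.Balaban1983to89.Site.tdist (Summit.QuantumFields.YangMills.Theorems.K0RecordFormatNames.coarsenTo (k + 1) b.src) y : ℝ)))) → ∀ α₂ : ℝ, 0 < α₂ → ∃ C₉ δ₀ : ℝ, 0 ≤ C₉ ∧ 0 < δ₀ ∧ ∀ k : ℕ, ∀ ε₂₉ : ℝ, 0 < ε₂₉ → (∀ a : (Summit.QuantumFields.YangMills.Theorems.K0RecordFormatNames.thetaFill F a₀ ε₂₉).ιβ, Literature.MathematicalPhysics.QuantumFieldTheory.Balaban1983to89.B12FormatPlus.Response9D (Summit.QuantumFields.YangMills.Theorems.K0RecordFormatNames.recordResponse9DataFromL F (Summit.QuantumFields.YangMills.Theorems.K0RecordFormatNames.thetaFill F a₀ ε₂₉) a Mc k (Summit.QuantumFields.YangMills.Theorems.K0RecordFormatNames.recordK₀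 F Mc k)) (fun n => Summit.QuantumFields.YangMills.Theorems.K0RecordFormatNames.recordChartJ F Mc k (Summit.QuantumFields.YangMills.Theorems.K0RecordFormatNames.recordK₀ F Mc k + n)) (fun n => Summit.QuantumFields.YangMills.Theorems.K0RecordFormatNames.recordRNat F Mc k (Summit.QuantumFields.YangMills.Theorems.K0RecordFormatNames.recordK₀ F Mc k + n)) (fun n X => Summit.QuantumFields.YangMills.Theorems.K0RecordFormatNames.recordDom44J F Mc k (Summit.QuantumFields.YangMills.Theorems.K0RecordFormatNames.recordK₀ F Mc k + n) X α₂) C₉ δ₀) ∧ ∀ n : ℕ, letI θ := Summit.QuantumFields.YangMills.Theorems.K0RecordFormatNames.thetaFill F a₀ ε₂₉; letI := θ.instVβ₁; letI := θ.instVβ₂; ContDiffAt ℝ 2 (Summit.QuantumFields.YangMills.Theorems.K0RecordFormatNames.recordEmbJ F θ k (Summit.QuantumFields.YangMills.Theorems.K0RecordFormatNames.recordK₀ F Mc k + n)) 0 ∧ Summit.QuantumFields.YangMills.Theorems.K0RecordFormatNames.recordEmbJ F θ k (Summit.QuantumFields.YangMills.Theorems.K0RecordFormatNames.recordK₀ F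 Mc k + n) 0 = 0 := by
  intro F Mc j c c₀ c₁ B₃ B₃' a₀ a₁ hMc hc hc₀ hc₁ hB₃ hB₃' ha₀ ha₁ h8 h9 hE hreg hL α₂ hα₂
  obtain ⟨C₄, δ₄, hC4, hδ4, hR4B⟩ := hR4 F Mc j c c₀ c₁ B₃ B₃' a₀ a₁ hMc hc hc₀ hc₁ hB₃ hB₃' ha₀ ha₁ h8 h9 hE hreg hL α₂ hα₂
  obtain ⟨CL, δL, hCL0, hδL, hLall⟩ := hL
  set A : ℝ := 2 * (2 * CL + 2 * ‖LinearMap.toContinuousLinearMap ((Summit.QuantumFields.YangMills.Theorems.K0RecordFormatNames.sl2Proj).restrictScalars ℝ)‖ * CL + 1) *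
    Real.exp (4 * δL * Mc) / α₂ with hA
  have hA0 : 0 ≤ A := by rw [hA]; positivity
  refine ⟨max A C₄, min δL δ₄, le_max_of_le_left hA0, lt_min hδL hδ4, fun k ε₂₉ hε => ?_⟩
  letI := (Summit.QuantumFields.YangMills.Theorems.K0RecordFormatNames.thetaFill F a₀ ε₂₉).instVβ₁
  letI := (Summit.QuantumFields.YangMills.Theorems.K0RecordFormatNames.thetaFill F a₀ ε₂₉).instVβ₂
  letI := (Summit.QuantumFields.YangMills.Theorems.K0RecordFormatNames.thetaFill F a₀ ε₂₉).instιβ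
  refine ⟨fun a => ?_, fun n => ⟨?_, ?_⟩⟩
  · refine response9D_fromL_of_decayRows hMc (Summit.QuantumFields.YangMills.Theorems.K0RecordFormatNames.thetaFill F a₀ ε₂₉) a k (le_max_of_le_left hA0) (lt_min hδL hδ4).le ?_ ?_
    · intro n X y
      obtain ⟨μ0, y0⟩ := y
      have hd2 := (hreg k n ε₂₉ hε).contDiffAt (n := 2)
      have hrow := rowR1D_L_at (F := F) hMc (Nat.le_add_right _ _) (Summit.QuantumFields.YangMills.Theorems.K0RecordFormatNames.thetaFill F a₀ ε₂₉) ha₀ hd2 a (μ0, y0) X hα₂ hCL0 hδL.le (fun b => hLall k n ε₂₉ hε a μ0 y0 b)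
      refine hrow.trans ?_
      have hd0 : 0 ≤ (Summit.QuantumFields.YangMills.Theorems.K0RecordFormatNames.recordSiteGeom F Mc k (Summit.QuantumFields.YangMills.Theorems.K0RecordFormatNames.recordK₀ F Mc k + n)).distD (μ0, y0) X := (Summit.QuantumFields.YangMills.Theorems.K0RecordFormatNames.recordSiteGeom F Mc k (Summit.QuantumFields.YangMills.Theorems.K0RecordFormatNames.recordK₀ F Mc k + n)).distD_nonneg (μ0, y0) X
      have hexp : Real.exp (-δL * (Summit.QuantumFields.YangMills.Theorems.K0RecordFormatNames.recordSiteGeom F Mc k (Summit.QuantumFields.YangMills.Theorems.K0RecordFormatNames.recordK₀ F Mc k + n)).distD (μ0, y0) X) ≤ Real.exp (-(min δL δ₄) * (Summit.QuantumFields.YangMills.Theorems.K0RecordFormatNames.recordSiteGeom F Mc k (Summit.QuantumFields.YangMills.Theorems.K0RecordFormatNames.recordK₀ F Mc k + n)).distD (μ0, y0) X) :=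
        Real.exp_le_exp.2 (by nlinarith [min_le_left δL δ₄])
      calc A * Real.exp (-δL * (Summit.QuantumFields.YangMills.Theorems.K0RecordFormatNames.recordSiteGeom F Mc k (Summit.QuantumFields.YangMills.Theorems.K0RecordFormatNames.recordK₀ F Mc k + n)).distD (μ0, y0) X)
          ≤ max A C₄ * Real.exp (-δL * (Summit.QuantumFields.YangMills.Theorems.K0RecordFormatNames.recordSiteGeom F Mc k (Summit.QuantumFields.YangMills.Theorems.K0RecordFormatNames.recordK₀ F Mc k + n)).distD (μ0, y0) X) := mul_le_mul_of_nonneg_right (le_max_left _ _) (Real.exp_pos _).le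
        _ ≤ max A C₄ * Real.exp (-(min δL δ₄) * (Summit.QuantumFields.YangMills.Theorems.K0RecordFormatNames.recordSiteGeom F Mc k (Summit.QuantumFields.YangMills.Theorems.K0RecordFormatNames.recordK₀ F Mc k + n)).distD (μ0, y0) X) := mul_le_mul_of_nonneg_left hexp (hA0.trans (le_max_left _ _))
    · intro n X hX μ z hz
      have h4 := hR4B k ε₂₉ hε a n X hX μ z hz
      refine h4.trans ?_
      have hR0 : 0 ≤ (Summit.QuantumFields.YangMills.Theorems.K0RecordFormatNames.recordRNat F Mc k (Summit.QuantumFields.YangMills.Theorems.K0RecordFormatNames.recordK₀ F Mc k + n) : ℝ) := Nat.cast_nonneg _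
      have hd0 : 0 ≤ (Summit.QuantumFields.YangMills.Theorems.K0RecordFormatNames.recordSiteGeom F Mc k (Summit.QuantumFields.YangMills.Theorems.K0RecordFormatNames.recordK₀ F Mc k + n)).distD (Summit.QuantumFields.YangMills.Theorems.K0RecordFormatNames.recordE F k (Summit.QuantumFields.YangMills.Theorems.K0RecordFormatNames.recordK₀ F Mc k + n) μ z) X := (Summit.QuantumFields.YangMills.Theorems.K0RecordFormatNames.recordSiteGeom F Mc k (Summit.QuantumFields.YangMills.Theorems.K0RecordFormatNames.recordK₀ F Mc k + n)).distD_nonneg _ X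
      have hm4 : min δL δ₄ ≤ δ₄ := min_le_right _ _
      have he1 : Real.exp (-δ₄ * (Summit.QuantumFields.YangMills.Theorems.K0RecordFormatNames.recordRNat F Mc k (Summit.QuantumFields.YangMills.Theorems.K0RecordFormatNames.recordK₀ F Mc k + n) : ℝ) / 2) ≤
          Real.exp (-(min δL δ₄) * (Summit.QuantumFields.YangMills.Theorems.K0RecordFormatNames.recordRNat F Mc k (Summit.QuantumFields.YangMills.Theorems.K0RecordFormatNames.recordK₀ F Mc k + n) : ℝ) / 2) := Real.exp_le_exp.2 (by nlinarith)
      have he2 : Real.exp (-(δ₄ / 2) * (Summit.QuantumFields.YangMills.Theorems.K0RecordFormatNames.recordSiteGeom F Mc k (Summit.QuantumFields.YangMills.Theorems.K0RecordFormatNames.recordK₀ F Mc k + n)).distD (Summit.QuantumFields.YangMills.Theorems.K0RecordFormatNames.recordE F k (Summit.QuantumFields.YangMills.Theorems.K0RecordFormatNames.recordK₀ F Mc k + n) μ z) X) ≤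
          Real.exp (-(min δL δ₄ / 2) * (Summit.QuantumFields.YangMills.Theorems.K0RecordFormatNames.recordSiteGeom F Mc k (Summit.QuantumFields.YangMills.Theorems.K0RecordFormatNames.recordK₀ F Mc k + n)).distD (Summit.QuantumFields.YangMills.Theorems.K0RecordFormatNames.recordE F k (Summit.QuantumFields.YangMills.Theorems.K0RecordFormatNames.recordK₀ F Mc k + n) μ z) X) :=
        Real.exp_le_exp.2 (by nlinarith)
      exact mul_le_mul (mul_le_mul (le_max_right A C₄) he1 (Real.exp_pos _).le (hC4.trans (le_max_right A C₄))) he2 (Real.exp_pos _).le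
        (mul_nonneg (hC4.trans (le_max_right A C₄)) (Real.exp_pos _).le)
  · exact contDiffAt_recordEmbJ_of_tokP9reg F a₀ ε₂₉ ha₀ Mc k n (hreg k n ε₂₉ hε)
  · exact recordEmbJ_zero_thetaFill F a₀ ε₂₉ ha₀ Mc k n

end Summit.QuantumFields.YangMills.Theorems.PortU8

end
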